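import Summits.Ventures.LatticeQCDFlow.Scaling.ParallelTemperingSwapKernel
import Summits.Ventures.LatticeQCDFlow.Scaling.TiltedPiMeasure

/-!
HONEST FRAMING: exact (Metropolis-corrected) sampling algorithms for lattice gauge theory; figures
of merit are autocorrelation/cost numbers at stated couplings and volumes; no continuum-physics
claim.

# ParallelTemperingSwapKernelBalance — DETAILED BALANCE OF THE REPLICA-EXCHANGE SWAP KERNEL WITH RESPECT TO
# THE TAGGED PRODUCT TARGET; HENCE INVARIANCE (lean-2 GEN-14, ours)

Venture-side (OURS).  Cell `lqcd-flow` (pub-lqcd), unit `pub-lqcd-lean-2-g14`, 2026-08-24.  Hypothesis (i) of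
GEN-13's replica-exchange law (`Scaling/ParallelTemperingDiffusive.pt_level_lagOneAutocorr_ge`:
`Kernel.Invariant κ (ptTaggedTarget X μ β K)`) for the swap kernel CONSTRUCTED in
`Scaling/ParallelTemperingSwapKernel` (`ptSwapKernel hXm β K`: uniformly chosen adjacent pair, exact Metropolis
test `ptPairRatio`, the tag follows its configuration), in the strong form of DETAILED BALANCE
(`Kernel.IsReversible`).  Mechanism: the i.i.d. product `⊗_k μ` is invariant under exchanging two coordinates
(`pi_map_ptConfSwap`); the product of the level laws is its tilt by `F(x) = Σ_k β_k X(x_k)`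
(GEN-12's `pi_tilted_sum`); exchanging levels `j, j+1` changes `F` by `a_j(x) = (β_{j+1}−β_j)(X(x_j)−X(x_{j+1}))`,
so `∫⁻ h(x∘σ_j) d(⊗μ_{β_k}) = ∫⁻ e^{a_j}·h d(⊗μ_{β_k})` (**`lintegral_comp_ptConfSwap`**, the swap lemma), and the
Metropolis test satisfies `r_j(x∘σ_j)·e^{a_j(x)} = r_j(x)`.

## What is proved (`X` measurable; `μ` a probability measure and `X` bounded for the balance statements)

* `lintegral_ptTaggedTarget` — `∫⁻ g dπ = (K+1)⁻¹·Σ_τ ∫⁻ g(τ,·) d(⊗_k μ_{β_k})`.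
* `pi_map_ptConfSwap`, `lintegral_comp_ptConfSwap_pi` — `⊗_k ν` is invariant under `x ↦ x∘σ_j`.
* `ptPotential_confSwap` — `F(x∘σ_j) = F(x) + a_j(x)`; **`lintegral_comp_ptConfSwap`** — the swap lemma.
* `ptSwapFlux`, `ptSwapStay` (the flux / stay functionals of one pair), `ptSwapStay_comm`,
  **`ptSwapFlux_comm`** (`T_j(A,B) = T_j(B,A)` — detailed balance pair by pair), **`setLIntegral_ptSwapKernel`**
  (`∫⁻_A κ(·,B) dπ = (K+1)⁻¹K⁻¹·Σ_j (T_j(A,B) + S_j(A,B))`).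
* **`isReversible_ptSwapKernel`** — `Kernel.IsReversible (ptSwapKernel hXm β K) (ptTaggedTarget X μ β K)`;
  **`invariant_ptSwapKernel`** — hypothesis (i) (`K ≥ 1`).

NOT CLAIMED: anything beyond the swap kernel (within-replica updates are composed abstractly in the companion
algorithm file).  Literature grade (cell rule): TEXTBOOK (detailed balance of the exchange move — Hukushima–Nemoto
1996 §2), NEW TYPING (general measurable `Ω`, Mathlib `Kernel.IsReversible`); nothing cited as a fact.
-/

noncomputable section

open MeasureTheory ProbabilityTheory Set Filter Finset
open scoped ENNReal

namespace Summit.Ventures.LatticeQCDFlow.Scaling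

/-! ## §1 Integration against the tagged target; the swap lemma -/

section SwapLemma

variable {Ω : Type*} [MeasurableSpace Ω] {X : Ω → ℝ} {μ : Measure Ω} {β : ℕ → ℝ} {K : ℕ}

/-- Lebesgue integration against the tagged target: `∫⁻ g dπ = (K+1)⁻¹·Σ_τ ∫⁻ g(τ, x) d(⊗_k μ_{β_k})(x)`. [ours] -/
theorem lintegral_ptTaggedTarget {g : Fin (K + 1) × (Fin (K + 1) → Ω) → ℝ≥0∞} (hg : Measurable g) :
    ∫⁻ z, g z ∂(ptTaggedTarget X μ β K) = ((K + 1 : ℕ) : ℝ≥0∞)⁻¹ *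
      ∑ τ : Fin (K + 1), ∫⁻ x, g (τ, x) ∂(Measure.pi fun k : Fin (K + 1) => μ.tilted fun x => β k * X x) := by
  unfold ptTaggedTarget
  rw [lintegral_smul_measure, lintegral_finsetSum_measure, smul_eq_mul]
  congr 1
  refine Finset.sum_congr rfl fun τ _ => ?_
  rw [lintegral_map hg measurable_prodMk_left]

/-- **An i.i.d. product is invariant under exchanging two coordinates.** [folklore] -/
theorem pi_map_ptConfSwap (ν : Measure Ω) [SigmaFinite ν] (j : Fin K) :
    (Measure.pi fun _ : Fin (K + 1) => ν).map (ptConfSwap K j) = Measure.pi fun _ : Fin (K + 1) => ν := by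
  refine (Measure.pi_eq fun s hs => ?_).symm
  rw [Measure.map_apply (measurable_ptConfSwap j) (MeasurableSet.univ_pi hs)]
  have e : ptConfSwap K j ⁻¹' (Set.univ.pi s) = Set.univ.pi fun k => s (ptPerm K j k) := by
    ext x
    simp only [Set.mem_preimage, Set.mem_univ_pi, ptConfSwap]
    constructor
    · intro h k
      have := h (ptPerm K j k)
      rwa [ptPerm_ptPerm] at this
    · intro h k
      have := h (ptPerm K j k)
      rwa [ptPerm_ptPerm] at this
  rw [e, Measure.pi_pi]
  exact Equiv.prod_comp (ptPerm K j) (fun k => ν (s k))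

/-- Substitution `x ↦ x∘σ_j` under an i.i.d. product. [folklore] -/
theorem lintegral_comp_ptConfSwap_pi (ν : Measure Ω) [SigmaFinite ν] (j : Fin K)
    {h : (Fin (K + 1) → Ω) → ℝ≥0∞} (hh : Measurable h) :
    ∫⁻ x, h (ptConfSwap K j x) ∂(Measure.pi fun _ : Fin (K + 1) => ν) =
      ∫⁻ x, h x ∂(Measure.pi fun _ : Fin (K + 1) => ν) := by
  rw [← lintegral_map hh (measurable_ptConfSwap j), pi_map_ptConfSwap]

/-- The joint potential `F(x) = Σ_k β_k X(x_k)` is measurable. [folklore] -/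
theorem measurable_ptPotential (hXm : Measurable X) :
    Measurable fun x : Fin (K + 1) → Ω => ∑ k : Fin (K + 1), β k * X (x k) :=
  Finset.measurable_sum _ fun k _ => (hXm.comp (measurable_pi_apply k)).const_mul _

omit [MeasurableSpace Ω] in
/-- **Exchanging levels `j, j+1` changes the potential by `a_j`**:
`F(x∘σ_j) = F(x) + (β_{j+1}−β_j)(X(x_j) − X(x_{j+1}))`. [ours] -/
theorem ptPotential_confSwap (j : Fin K) (x : Fin (K + 1) → Ω) :
    ∑ k : Fin (K + 1), β k * X (ptConfSwap K j x k) =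
      ∑ k : Fin (K + 1), β k * X (x k) +
        (β ((j : ℕ) + 1) - β (j : ℕ)) * (X (x (Fin.castSucc j)) - X (x (Fin.succ j))) := by
  have hne : Fin.castSucc j ≠ Fin.succ j := ne_of_lt Fin.castSucc_lt_succ
  -- reindex the swapped sum by `σ_j`
  have e1 : ∑ k : Fin (K + 1), β k * X (ptConfSwap K j x k) = ∑ k : Fin (K + 1), β (ptPerm K j k) * X (x k) := by
    rw [← Equiv.sum_comp (ptPerm K j) (fun k => β (ptPerm K j k) * X (x k))]
    refine Finset.sum_congr rfl fun k _ => ?_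
    simp only [ptConfSwap, ptPerm_ptPerm]
  rw [e1, ← sub_eq_iff_eq_add', ← Finset.sum_sub_distrib]
  rw [Fintype.sum_eq_add (Fin.castSucc j) (Fin.succ j) hne (fun k hk => by
    have : ptPerm K j k = k := by
      by_contra h
      rcases (ptPerm_ne_self_iff j k).1 h with h' | h'
      · exact hk.1 h'
      · exact hk.2 h'
    rw [this, sub_self])]
  rw [ptPerm_castSucc, ptPerm_succ]
  simp only [Fin.val_succ, Fin.val_castSucc]
  ring

variable [IsProbabilityMeasure μ]

/-- The product of the level laws is the tilt of the i.i.d. product by the joint potential (GEN-12's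
`pi_tilted_sum`). [ours] -/
theorem pi_tilted_mul_eq (hXm : Measurable X) (hXb : ∃ C, ∀ x, |X x| ≤ C) :
    (Measure.pi fun k : Fin (K + 1) => μ.tilted fun x => β k * X x) =
      (Measure.pi fun _ : Fin (K + 1) => μ).tilted fun x => ∑ k : Fin (K + 1), β k * X (x k) :=
  (pi_tilted_sum (fun _ : Fin (K + 1) => μ) (fun k x => β k * X x)
    fun k => integrable_exp_mul_of_bounded hXm hXb (β k)).symm

/-- **THE SWAP LEMMA**: for measurable `h ≥ 0`,
`∫⁻ h(x∘σ_j) d(⊗_k μ_{β_k}) = ∫⁻ e^{(β_{j+1}−β_j)(X(x_j)−X(x_{j+1}))}·h(x) d(⊗_k μ_{β_k})`. [ours] -/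
theorem lintegral_comp_ptConfSwap (hXm : Measurable X) (hXb : ∃ C, ∀ x, |X x| ≤ C) (j : Fin K)
    {h : (Fin (K + 1) → Ω) → ℝ≥0∞} (hh : Measurable h) :
    ∫⁻ x, h (ptConfSwap K j x) ∂(Measure.pi fun k : Fin (K + 1) => μ.tilted fun x => β k * X x) =
      ∫⁻ x, ENNReal.ofReal (Real.exp ((β ((j : ℕ) + 1) - β (j : ℕ)) * (X (x (Fin.castSucc j)) - X (x (Fin.succ j)))))
        * h x ∂(Measure.pi fun k : Fin (K + 1) => μ.tilted fun x => β k * X x) := by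
  rw [pi_tilted_mul_eq hXm hXb, lintegral_tilted, lintegral_tilted]
  set Z : ℝ := ∫ x, Real.exp (∑ k : Fin (K + 1), β k * X (x k)) ∂(Measure.pi fun _ : Fin (K + 1) => μ) with hZ
  have hF := measurable_ptPotential (β := β) (K := K) hXm
  -- write the integrand as `ψ ∘ σ_j` with `ψ(y) = e^{F(y∘σ_j)}/Z · h(y)`
  have hψ : Measurable fun y : Fin (K + 1) → Ω =>
      ENNReal.ofReal (Real.exp (∑ k : Fin (K + 1), β k * X (ptConfSwap K j y k)) / Z) * h y :=
    (((hF.comp (measurable_ptConfSwap j)).exp.div_const _).ennreal_ofReal).mul hh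
  have e1 : (fun x : Fin (K + 1) → Ω => ENNReal.ofReal (Real.exp (∑ k : Fin (K + 1), β k * X (x k)) / Z) *
      h (ptConfSwap K j x)) = fun x => (fun y => ENNReal.ofReal
        (Real.exp (∑ k : Fin (K + 1), β k * X (ptConfSwap K j y k)) / Z) * h y) (ptConfSwap K j x) := by
    funext x
    simp only [ptConfSwap_ptConfSwap]
  rw [e1, lintegral_comp_ptConfSwap_pi μ j hψ]
  refine lintegral_congr fun y => ?_
  have hZ0 : 0 ≤ Real.exp (∑ k : Fin (K + 1), β k * X (y k)) / Z :=
    div_nonneg (Real.exp_pos _).le (integral_nonneg fun x => (Real.exp_pos _).le)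
  rw [ptPotential_confSwap, Real.exp_add, ← mul_assoc, ← ENNReal.ofReal_mul hZ0]
  congr 2
  ring

end SwapLemma

/-! ## §2 Detailed balance -/

section Balance

variable {Ω : Type*} [MeasurableSpace Ω] {X : Ω → ℝ} {μ : Measure Ω} {β : ℕ → ℝ} {K : ℕ}

/-- The stationary SWAP-FLUX functional of the pair `(j, j+1)`:
`T_j(A,B) = Σ_τ ∫⁻ 1_A(τ,x)·1_B(σ_jτ, x∘σ_j)·r_j(x) d(⊗μ_{β_k})`. [ours] -/
def ptSwapFlux (X : Ω → ℝ) (μ : Measure Ω) (β : ℕ → ℝ) (K : ℕ) (j : Fin K)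
    (A B : Set (Fin (K + 1) × (Fin (K + 1) → Ω))) : ℝ≥0∞ :=
  ∑ τ : Fin (K + 1), ∫⁻ x, A.indicator 1 ((τ, x) : Fin (K + 1) × (Fin (K + 1) → Ω)) *
    B.indicator 1 (ptSwapMap K j (τ, x)) * ENNReal.ofReal (ptPairRatio X β K j x)
      ∂(Measure.pi fun k : Fin (K + 1) => μ.tilted fun x => β k * X x)

/-- The stationary STAY functional of the pair `(j, j+1)`:
`S_j(A,B) = Σ_τ ∫⁻ 1_A(τ,x)·1_B(τ,x)·(1 − r_j(x)) d(⊗μ_{β_k})`. [ours] -/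
def ptSwapStay (X : Ω → ℝ) (μ : Measure Ω) (β : ℕ → ℝ) (K : ℕ) (j : Fin K)
    (A B : Set (Fin (K + 1) × (Fin (K + 1) → Ω))) : ℝ≥0∞ :=
  ∑ τ : Fin (K + 1), ∫⁻ x, A.indicator 1 ((τ, x) : Fin (K + 1) × (Fin (K + 1) → Ω)) *
    B.indicator 1 ((τ, x) : Fin (K + 1) × (Fin (K + 1) → Ω)) * ENNReal.ofReal (1 - ptPairRatio X β K j x)
      ∂(Measure.pi fun k : Fin (K + 1) => μ.tilted fun x => β k * X x)

/-- The stay functional is symmetric. [ours] -/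
theorem ptSwapStay_comm (j : Fin K) (A B : Set (Fin (K + 1) × (Fin (K + 1) → Ω))) :
    ptSwapStay X μ β K j A B = ptSwapStay X μ β K j B A := by
  unfold ptSwapStay
  refine Finset.sum_congr rfl fun τ _ => lintegral_congr fun x => ?_
  ring

/-- **DETAILED BALANCE PAIR BY PAIR: the swap flux is symmetric**, `T_j(A,B) = T_j(B,A)` (`μ` a probability
measure, `X` bounded measurable). [ours] -/
theorem ptSwapFlux_comm [IsProbabilityMeasure μ] (hXm : Measurable X) (hXb : ∃ C, ∀ x, |X x| ≤ C) (j : Fin K)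
    {A B : Set (Fin (K + 1) × (Fin (K + 1) → Ω))} (hA : MeasurableSet A) (hB : MeasurableSet B) :
    ptSwapFlux X μ β K j A B = ptSwapFlux X μ β K j B A := by
  unfold ptSwapFlux
  -- reindex the tag sum on the left by `σ_j`
  rw [← Equiv.sum_comp (ptPerm K j) (fun τ => ∫⁻ x, A.indicator 1 ((τ, x) : Fin (K + 1) × (Fin (K + 1) → Ω)) *
    B.indicator 1 (ptSwapMap K j (τ, x)) * ENNReal.ofReal (ptPairRatio X β K j x)
      ∂(Measure.pi fun k : Fin (K + 1) => μ.tilted fun x => β k * X x))]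
  refine Finset.sum_congr rfl fun τ _ => ?_
  -- the `τ`-term: substitute `x ↦ x∘σ_j` (swap lemma) and use `r_j(x∘σ)·e^{a_j(x)} = r_j(x)`
  have hiA : Measurable fun y : Fin (K + 1) → Ω =>
      A.indicator (1 : Fin (K + 1) × (Fin (K + 1) → Ω) → ℝ≥0∞) (ptSwapMap K j (τ, y)) :=
    measurable_indicator_one_comp ((measurable_ptSwapMap j).comp measurable_prodMk_left) hA
  have hiB : Measurable fun y : Fin (K + 1) → Ω =>
      B.indicator (1 : Fin (K + 1) × (Fin (K + 1) → Ω) → ℝ≥0∞) ((τ, y) : Fin (K + 1) × (Fin (K + 1) → Ω)) :=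
    measurable_indicator_one_comp measurable_prodMk_left hB
  have hr : Measurable fun y : Fin (K + 1) → Ω => ENNReal.ofReal (ptPairRatio X β K j (ptConfSwap K j y)) :=
    ((measurable_ptPairRatio (β := β) hXm j).comp (measurable_ptConfSwap j)).ennreal_ofReal
  have hh : Measurable fun y : Fin (K + 1) → Ω =>
      A.indicator (1 : Fin (K + 1) × (Fin (K + 1) → Ω) → ℝ≥0∞) (ptSwapMap K j (τ, y)) *
        B.indicator 1 ((τ, y) : Fin (K + 1) × (Fin (K + 1) → Ω)) *
        ENNReal.ofReal (ptPairRatio X β K j (ptConfSwap K j y)) := (hiA.mul hiB).mul hr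
  have e1 : (fun x : Fin (K + 1) → Ω => A.indicator 1 ((ptPerm K j τ, x) : Fin (K + 1) × (Fin (K + 1) → Ω)) *
      B.indicator 1 (ptSwapMap K j (ptPerm K j τ, x)) * ENNReal.ofReal (ptPairRatio X β K j x)) =
      fun x => (fun y : Fin (K + 1) → Ω =>
        A.indicator (1 : Fin (K + 1) × (Fin (K + 1) → Ω) → ℝ≥0∞) (ptSwapMap K j (τ, y)) *
          B.indicator 1 ((τ, y) : Fin (K + 1) × (Fin (K + 1) → Ω)) *
          ENNReal.ofReal (ptPairRatio X β K j (ptConfSwap K j y))) (ptConfSwap K j x) := by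
    funext x
    simp only [ptSwapMap, ptPerm_ptPerm, ptConfSwap_ptConfSwap]
  rw [e1, lintegral_comp_ptConfSwap hXm hXb j hh]
  refine lintegral_congr fun x => ?_
  have hexp : 0 ≤ Real.exp ((β ((j : ℕ) + 1) - β (j : ℕ)) * (X (x (Fin.castSucc j)) - X (x (Fin.succ j)))) :=
    (Real.exp_pos _).le
  -- collect `e^{a}·r_j(x∘σ) = r_j(x)`
  calc ENNReal.ofReal (Real.exp ((β ((j : ℕ) + 1) - β (j : ℕ)) * (X (x (Fin.castSucc j)) - X (x (Fin.succ j))))) *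
        (A.indicator 1 (ptSwapMap K j (τ, x)) * B.indicator 1 ((τ, x) : Fin (K + 1) × (Fin (K + 1) → Ω)) *
          ENNReal.ofReal (ptPairRatio X β K j (ptConfSwap K j x)))
      = B.indicator 1 ((τ, x) : Fin (K + 1) × (Fin (K + 1) → Ω)) * A.indicator 1 (ptSwapMap K j (τ, x)) *
          (ENNReal.ofReal (ptPairRatio X β K j (ptConfSwap K j x)) * ENNReal.ofReal
            (Real.exp ((β ((j : ℕ) + 1) - β (j : ℕ)) * (X (x (Fin.castSucc j)) - X (x (Fin.succ j)))))) := by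
        ring
    _ = B.indicator 1 ((τ, x) : Fin (K + 1) × (Fin (K + 1) → Ω)) * A.indicator 1 (ptSwapMap K j (τ, x)) *
          ENNReal.ofReal (ptPairRatio X β K j x) := by
        rw [← ENNReal.ofReal_mul (ptPairRatio_mem j _).1, ptPairRatio_confSwap_mul_exp]

/-- **`∫⁻_A κ(·, B) dπ = (K+1)⁻¹·K⁻¹·Σ_j (T_j(A,B) + S_j(A,B))`** — the expansion of the stationary flow from `A`
into `B` over the pairs. [ours] -/
theorem setLIntegral_ptSwapKernel (hXm : Measurable X) {A B : Set (Fin (K + 1) × (Fin (K + 1) → Ω))}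
    (hA : MeasurableSet A) (hB : MeasurableSet B) :
    ∫⁻ z in A, ptSwapKernel hXm β K z B ∂(ptTaggedTarget X μ β K) =
      ((K + 1 : ℕ) : ℝ≥0∞)⁻¹ * (((K : ℕ) : ℝ≥0∞)⁻¹ *
        ∑ j : Fin K, (ptSwapFlux X μ β K j A B + ptSwapStay X μ β K j A B)) := by
  rw [← lintegral_indicator hA, lintegral_ptTaggedTarget (((ptSwapKernel hXm β K).measurable_coe hB).indicator hA)]
  congr 1
  -- pointwise expansion of `1_A(z)·κ(z,B)`
  have hpt : ∀ (τ : Fin (K + 1)) (x : Fin (K + 1) → Ω),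
      A.indicator (fun z => ptSwapKernel hXm β K z B) ((τ, x)) = ((K : ℕ) : ℝ≥0∞)⁻¹ * ∑ j : Fin K,
        (A.indicator 1 ((τ, x) : Fin (K + 1) × (Fin (K + 1) → Ω)) * B.indicator 1 (ptSwapMap K j (τ, x)) *
            ENNReal.ofReal (ptPairRatio X β K j x) +
          A.indicator 1 ((τ, x) : Fin (K + 1) × (Fin (K + 1) → Ω)) *
            B.indicator 1 ((τ, x) : Fin (K + 1) × (Fin (K + 1) → Ω)) * ENNReal.ofReal (1 - ptPairRatio X β K j x)) := by
    intro τ x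
    by_cases hz : ((τ, x) : Fin (K + 1) × (Fin (K + 1) → Ω)) ∈ A
    · rw [Set.indicator_of_mem hz, Set.indicator_of_mem hz, ptSwapKernel_apply' hXm _ hB]
      simp only [Pi.one_apply, one_mul]
      congr 1
      refine Finset.sum_congr rfl fun j _ => ?_
      ring
    · rw [Set.indicator_of_notMem hz, Set.indicator_of_notMem hz]
      simp
  -- measurability of the summands
  have hiA : ∀ τ : Fin (K + 1), Measurable fun x : Fin (K + 1) → Ω =>
      A.indicator (1 : Fin (K + 1) × (Fin (K + 1) → Ω) → ℝ≥0∞) ((τ, x)) :=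
    fun τ => measurable_indicator_one_comp measurable_prodMk_left hA
  have hiB : ∀ τ : Fin (K + 1), Measurable fun x : Fin (K + 1) → Ω =>
      B.indicator (1 : Fin (K + 1) × (Fin (K + 1) → Ω) → ℝ≥0∞) ((τ, x)) :=
    fun τ => measurable_indicator_one_comp measurable_prodMk_left hB
  have hiBs : ∀ (τ : Fin (K + 1)) (j : Fin K), Measurable fun x : Fin (K + 1) → Ω =>
      B.indicator (1 : Fin (K + 1) × (Fin (K + 1) → Ω) → ℝ≥0∞) (ptSwapMap K j (τ, x)) :=
    fun τ j => measurable_indicator_one_comp ((measurable_ptSwapMap j).comp measurable_prodMk_left) hB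
  have hr : ∀ j : Fin K, Measurable fun x : Fin (K + 1) → Ω => ENNReal.ofReal (ptPairRatio X β K j x) :=
    fun j => (measurable_ptPairRatio (β := β) hXm j).ennreal_ofReal
  have hr' : ∀ j : Fin K, Measurable fun x : Fin (K + 1) → Ω => ENNReal.ofReal (1 - ptPairRatio X β K j x) :=
    fun j => (measurable_const.sub (measurable_ptPairRatio (β := β) hXm j)).ennreal_ofReal
  have hT : ∀ (τ : Fin (K + 1)) (j : Fin K), Measurable fun x : Fin (K + 1) → Ω =>
      A.indicator 1 ((τ, x) : Fin (K + 1) × (Fin (K + 1) → Ω)) * B.indicator 1 (ptSwapMap K j (τ, x)) *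
        ENNReal.ofReal (ptPairRatio X β K j x) := fun τ j => ((hiA τ).mul (hiBs τ j)).mul (hr j)
  have hS : ∀ (τ : Fin (K + 1)) (j : Fin K), Measurable fun x : Fin (K + 1) → Ω =>
      A.indicator 1 ((τ, x) : Fin (K + 1) × (Fin (K + 1) → Ω)) *
        B.indicator 1 ((τ, x) : Fin (K + 1) × (Fin (K + 1) → Ω)) * ENNReal.ofReal (1 - ptPairRatio X β K j x) :=
    fun τ j => ((hiA τ).mul (hiB τ)).mul (hr' j)
  have hTS : ∀ (τ : Fin (K + 1)) (j : Fin K), Measurable fun x : Fin (K + 1) → Ω =>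
      A.indicator 1 ((τ, x) : Fin (K + 1) × (Fin (K + 1) → Ω)) * B.indicator 1 (ptSwapMap K j (τ, x)) *
          ENNReal.ofReal (ptPairRatio X β K j x) +
        A.indicator 1 ((τ, x) : Fin (K + 1) × (Fin (K + 1) → Ω)) *
          B.indicator 1 ((τ, x) : Fin (K + 1) × (Fin (K + 1) → Ω)) * ENNReal.ofReal (1 - ptPairRatio X β K j x) :=
    fun τ j => (hT τ j).add (hS τ j)
  -- integrate term by term and swap the two finite sums
  have hτ : ∀ τ : Fin (K + 1), ∫⁻ x, A.indicator (fun z => ptSwapKernel hXm β K z B) ((τ, x))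
      ∂(Measure.pi fun k : Fin (K + 1) => μ.tilted fun x => β k * X x) = ((K : ℕ) : ℝ≥0∞)⁻¹ * ∑ j : Fin K,
      (∫⁻ x, A.indicator 1 ((τ, x) : Fin (K + 1) × (Fin (K + 1) → Ω)) * B.indicator 1 (ptSwapMap K j (τ, x)) *
          ENNReal.ofReal (ptPairRatio X β K j x) ∂(Measure.pi fun k : Fin (K + 1) => μ.tilted fun x => β k * X x) +
        ∫⁻ x, A.indicator 1 ((τ, x) : Fin (K + 1) × (Fin (K + 1) → Ω)) *
          B.indicator 1 ((τ, x) : Fin (K + 1) × (Fin (K + 1) → Ω)) * ENNReal.ofReal (1 - ptPairRatio X β K j x)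
            ∂(Measure.pi fun k : Fin (K + 1) => μ.tilted fun x => β k * X x)) := by
    intro τ
    simp only [hpt]
    rw [lintegral_const_mul _ (Finset.measurable_sum _ fun j _ => hTS τ j), lintegral_finsetSum _ fun j _ => hTS τ j]
    congr 1
    refine Finset.sum_congr rfl fun j _ => ?_
    rw [lintegral_add_left (hT τ j)]
  simp only [hτ, ← Finset.mul_sum]
  congr 1
  rw [Finset.sum_comm]
  simp only [Finset.sum_add_distrib, ptSwapFlux, ptSwapStay]

/-- **DETAILED BALANCE: THE SWAP KERNEL IS REVERSIBLE WITH RESPECT TO THE TAGGED TARGET** (`μ` a probability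
measure, `X` bounded measurable). [ours] -/
theorem isReversible_ptSwapKernel [IsProbabilityMeasure μ] (hXm : Measurable X) (hXb : ∃ C, ∀ x, |X x| ≤ C) :
    Kernel.IsReversible (ptSwapKernel hXm β K) (ptTaggedTarget X μ β K) := by
  intro A B hA hB
  rw [setLIntegral_ptSwapKernel hXm hA hB, setLIntegral_ptSwapKernel hXm hB hA]
  have e : ∑ j : Fin K, (ptSwapFlux X μ β K j A B + ptSwapStay X μ β K j A B) =
      ∑ j : Fin K, (ptSwapFlux X μ β K j B A + ptSwapStay X μ β K j B A) :=
    Finset.sum_congr rfl fun j _ => by rw [ptSwapFlux_comm hXm hXb j hA hB, ptSwapStay_comm j A B]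
  rw [e]

/-- **(i) THE SWAP KERNEL LEAVES THE TAGGED TARGET INVARIANT** (`K ≥ 1`, `μ` a probability measure, `X` bounded
measurable). [ours] -/
theorem invariant_ptSwapKernel [IsProbabilityMeasure μ] [NeZero K] (hXm : Measurable X)
    (hXb : ∃ C, ∀ x, |X x| ≤ C) : Kernel.Invariant (ptSwapKernel hXm β K) (ptTaggedTarget X μ β K) :=
  (isReversible_ptSwapKernel hXm hXb).invariant

end Balance

end Summit.Ventures.LatticeQCDFlow.Scaling

end
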